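import Mathlib
import HarnessLib
import Summits.ResolutionOfSingularities.ResolutionOfSingularities.Theorems.WildQuotientsWildQuotientResolutionS1aA1Move2ModelRows
import Summits.ResolutionOfSingularities.ResolutionOfSingularities.Theorems.WildQuotientsWildQuotientResolutionS1aModelTools

/-!
# S1a — INSTANCE I-2 (a1): the free model of the node of the norm chart `N(x₁)` PACKAGED as one existence statement with all pins

[OURS · L1 W4.5c · lead-1 g13; plan-1 CHAIN v10.40 §4 ASSIGNMENT (i)/(iv) «shrink the terms … then a1_killsIn_three», R-F15c (I-2 := MT-a1″)] — NOT
statements of the manuscript; counted 0; AI-level work, weaker than expert review. Crux stmt-ResolutionOfSingularities-17941 `CyclicQuotientFourfolds`,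
line `s1a-logminvertex` v13 (`stub_reachLowerInFX`).

The assembly of the a1 kill tree feeds the abstract move theorems ✓`a1_move2` / ✓`a1_move3`; to keep its terms small, the model
`Φ₁ = chartRingEquivAway … (a1ModelEquiv e) : ChartRing ≃+* k[x_none, x′][1/h]` of the node of the norm chart of move 1 and the polynomial `h` are
introduced there as OPAQUE witnesses of the existence statement below, which carries every fact the assembly needs about them:
* ★★ `exists_a1NormChartModel` — `∃ h Φ`: `h = (∏ⱼ (X₁′ + j·X₀′·x_none))^{2d}` (✓`a1ModelEquiv_coverElement_one`); the ROWS of `τ′ = Φ⁻¹ ≫ σ_chart ≫ Φ` on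
  `x_none, X₀′, X₁′, x₂, x₃` and on `h⁻¹`, the constants, `h` (✓`a1_model_rows`, ✓`a1_sigmaP_h`); the DEGREES of `X₀′, x₂, X₁′, x₃, x_none, h⁻¹` in the
  transported node grading relative to `θ = consIndexEquiv r (1, 0)` (✓A1ModelPins, ✓`a1_model_degree_X_some_two`); and the PIN of the residual section
  `Φ(X₁^{n}/(yT^{dbar})) = X₀′^{n}·h⁻¹` (✓`chartRingEquivAway_residualSection`).
-/

set_option linter.dupNamespace false

noncomputable section

open Literature.AlgebraicGeometry.Resolution
open scoped LaurentPolynomial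
open MvPolynomial
open Summit.ResolutionOfSingularities.ResolutionOfSingularities.Theorems.WildQuotientResolution.S1
open Summit.ResolutionOfSingularities.ResolutionOfSingularities.Theorems.WildQuotientResolution.S1.CoarseChart
open Summit.ResolutionOfSingularities.ResolutionOfSingularities.Theorems.WildQuotientResolution.S1.ProducerStep
open Summit.ResolutionOfSingularities.ResolutionOfSingularities.Theorems.WildQuotientResolution.S1.ReesBigrading
open Summit.ResolutionOfSingularities.ResolutionOfSingularities.Theorems.WildQuotientResolution.S1.NodeTransport
open Summit.ResolutionOfSingularities.ResolutionOfSingularities.Theorems.WildQuotientResolution.S1.CobordantTransport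
open Summit.ResolutionOfSingularities.ResolutionOfSingularities.Theorems.WildQuotientResolution.S1.BlowupCharts
open Summit.ResolutionOfSingularities.ResolutionOfSingularities.Theorems.WildQuotientResolution.S1.FreeModel

namespace Summit.ResolutionOfSingularities.ResolutionOfSingularities.Theorems.WildQuotientResolution.S1.KillCert.A1

variable {k : Type} [Field k] {A : Type} [CommRing A]
  (σ : MvPolynomial (Fin 4) k ≃+* MvPolynomial (Fin 4) k) (hC : ∀ a : k, σ (C a) = C a)
  (h0 : σ (X 0) = X 0) (h1 : σ (X 1) = X 1 + X 0) (h2 : σ (X 2) = X 2 + X 0) (h3 : σ (X 3) = X 3 + X 1 * X 2)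
  (e : A ≃+* MvPolynomial (Fin 4) k) (τ : A ≃+* A) (hact : ∀ t : A, τ t = e.symm (σ (e t)))
  {p : ℕ} [NeZero p] (hp : 0 < p) (hσp : ∀ x : A, (⇑τ)^[p] x = x)
  (hσJ : ∀ n : ℕ, ((weightedFiltration (⇑e.symm ∘ ![X 0, X 1] : Fin 2 → A) ![2, 1]).ideal n).map (τ : A →+* A) ≤
    (weightedFiltration (⇑e.symm ∘ ![X 0, X 1] : Fin 2 → A) ![2, 1]).ideal n)
  {m : ℕ} (r : Fin m → ℕ) (𝒜 : (Π j : Fin m, ZMod (r j)) → AddSubgroup A) [GradedRing 𝒜]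
  (hf : ∀ i, (⇑e.symm ∘ ![X 0, X 1] : Fin 2 → A) i ∈ 𝒜 ((fun _ => (0 : Π j : Fin m, ZMod (r j))) i))
  (hx2 : e.symm (X 2) ∈ 𝒜 0) (hx3 : e.symm (X 3) ∈ 𝒜 0) (d : ℕ) (y : ↥(𝒜 0))
  (hyval : (y : A) = (∏ i : ZMod p, (e.symm (X 1) + (i.val : A) * e.symm (X 0))) ^ (2 * d))
  (hy : y ∈ (traceFiltration 𝒜 (⇑e.symm ∘ ![X 0, X 1] : Fin 2 → A) ![2, 1]).ideal (d * (2 * p))) (hσy : τ (y : A) = y)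

include hC h0 h1 h2 h3 hact hx2 hx3 hyval in
/-- ★★ **THE FREE MODEL OF THE NODE OF `N(x₁)`, PACKAGED**: a polynomial `h` and a ring isomorphism `Φ : ChartRing ≃+* k[x_none, x′][1/h]` with the product
form of `h`, the rows of `τ′ = Φ⁻¹σΦ`, the degrees of the generators and the residual-section pin. See the module docstring.
[OURS · L1 W4.5c · (F-T8) models, a1; NOT a statement of the manuscript] -/
theorem exists_a1NormChartModel :
    letI := chartNodeGradedRing r 𝒜 (⇑e.symm ∘ ![X 0, X 1] : Fin 2 → A) ![2, 1] hf (d * (2 * p)) y hy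
    ∃ (hh : MvPolynomial (Option (Fin 4)) k) (Φ : ChartRing 𝒜 (⇑e.symm ∘ ![X 0, X 1] : Fin 2 → A) ![2, 1] (d * (2 * p)) y hy ≃+* Localization.Away hh),
      hh = (∏ j : ZMod p, (X (some 1) + C (j.val : k) * (X (some 0) * X none))) ^ (2 * d) ∧
      -- rows of `τ′ = conj Φ σ_chart`
      conj Φ (sigmaChart 𝒜 (⇑e.symm ∘ ![X 0, X 1] : Fin 2 → A) ![2, 1] (d * (2 * p)) y hy τ hσJ hp hσp hσy)
          (algebraMap (MvPolynomial (Option (Fin 4)) k) (Localization.Away hh) (X none)) =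
        algebraMap (MvPolynomial (Option (Fin 4)) k) (Localization.Away hh) (X none) ∧
      conj Φ (sigmaChart 𝒜 (⇑e.symm ∘ ![X 0, X 1] : Fin 2 → A) ![2, 1] (d * (2 * p)) y hy τ hσJ hp hσp hσy)
          (algebraMap (MvPolynomial (Option (Fin 4)) k) (Localization.Away hh) (X (some 0))) =
        algebraMap (MvPolynomial (Option (Fin 4)) k) (Localization.Away hh) (X (some 0)) ∧
      conj Φ (sigmaChart 𝒜 (⇑e.symm ∘ ![X 0, X 1] : Fin 2 → A) ![2, 1] (d * (2 * p)) y hy τ hσJ hp hσp hσy)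
          (algebraMap (MvPolynomial (Option (Fin 4)) k) (Localization.Away hh) (X (some 1))) =
        algebraMap (MvPolynomial (Option (Fin 4)) k) (Localization.Away hh) (X (some 1)) +
          algebraMap (MvPolynomial (Option (Fin 4)) k) (Localization.Away hh) (X (some 0)) * algebraMap (MvPolynomial (Option (Fin 4)) k) (Localization.Away hh) (X none) ∧
      conj Φ (sigmaChart 𝒜 (⇑e.symm ∘ ![X 0, X 1] : Fin 2 → A) ![2, 1] (d * (2 * p)) y hy τ hσJ hp hσp hσy)
          (algebraMap (MvPolynomial (Option (Fin 4)) k) (Localization.Away hh) (X (some 2))) =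
        algebraMap (MvPolynomial (Option (Fin 4)) k) (Localization.Away hh) (X (some 2)) +
          algebraMap (MvPolynomial (Option (Fin 4)) k) (Localization.Away hh) (X none) ^ 2 * algebraMap (MvPolynomial (Option (Fin 4)) k) (Localization.Away hh) (X (some 0)) ∧
      conj Φ (sigmaChart 𝒜 (⇑e.symm ∘ ![X 0, X 1] : Fin 2 → A) ![2, 1] (d * (2 * p)) y hy τ hσJ hp hσp hσy)
          (algebraMap (MvPolynomial (Option (Fin 4)) k) (Localization.Away hh) (X (some 3))) =
        algebraMap (MvPolynomial (Option (Fin 4)) k) (Localization.Away hh) (X (some 3)) +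
          algebraMap (MvPolynomial (Option (Fin 4)) k) (Localization.Away hh) (X none) * algebraMap (MvPolynomial (Option (Fin 4)) k) (Localization.Away hh) (X (some 1)) *
            algebraMap (MvPolynomial (Option (Fin 4)) k) (Localization.Away hh) (X (some 2)) ∧
      (∀ g' ∈ (({IsLocalization.Away.invSelf hh} : Set (Localization.Away hh)) ∪ Set.range (algebraMap k (Localization.Away hh))),
        conj Φ (sigmaChart 𝒜 (⇑e.symm ∘ ![X 0, X 1] : Fin 2 → A) ![2, 1] (d * (2 * p)) y hy τ hσJ hp hσp hσy) g' = g') ∧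
      conj Φ (sigmaChart 𝒜 (⇑e.symm ∘ ![X 0, X 1] : Fin 2 → A) ![2, 1] (d * (2 * p)) y hy τ hσJ hp hσp hσy)
          (algebraMap (MvPolynomial (Option (Fin 4)) k) (Localization.Away hh) hh) =
        algebraMap (MvPolynomial (Option (Fin 4)) k) (Localization.Away hh) hh ∧
      -- degrees relative to `θ = consIndexEquiv r (1, 0)`
      algebraMap (MvPolynomial (Option (Fin 4)) k) (Localization.Away hh) (X (some 0)) ∈
        mapGrading (chartNodeGrading r 𝒜 (⇑e.symm ∘ ![X 0, X 1] : Fin 2 → A) ![2, 1] hf (d * (2 * p)) y hy) Φ (2 • consIndexEquiv r ((1 : ℤ), 0)) ∧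
      algebraMap (MvPolynomial (Option (Fin 4)) k) (Localization.Away hh) (X (some 2)) ∈
        mapGrading (chartNodeGrading r 𝒜 (⇑e.symm ∘ ![X 0, X 1] : Fin 2 → A) ![2, 1] hf (d * (2 * p)) y hy) Φ 0 ∧
      algebraMap (MvPolynomial (Option (Fin 4)) k) (Localization.Away hh) (X (some 1)) ∈
        mapGrading (chartNodeGrading r 𝒜 (⇑e.symm ∘ ![X 0, X 1] : Fin 2 → A) ![2, 1] hf (d * (2 * p)) y hy) Φ (consIndexEquiv r ((1 : ℤ), 0)) ∧
      algebraMap (MvPolynomial (Option (Fin 4)) k) (Localization.Away hh) (X (some 3)) ∈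
        mapGrading (chartNodeGrading r 𝒜 (⇑e.symm ∘ ![X 0, X 1] : Fin 2 → A) ![2, 1] hf (d * (2 * p)) y hy) Φ 0 ∧
      algebraMap (MvPolynomial (Option (Fin 4)) k) (Localization.Away hh) (X none) ∈
        mapGrading (chartNodeGrading r 𝒜 (⇑e.symm ∘ ![X 0, X 1] : Fin 2 → A) ![2, 1] hf (d * (2 * p)) y hy) Φ (-consIndexEquiv r ((1 : ℤ), 0)) ∧
      IsLocalization.Away.invSelf hh ∈
        mapGrading (chartNodeGrading r 𝒜 (⇑e.symm ∘ ![X 0, X 1] : Fin 2 → A) ![2, 1] hf (d * (2 * p)) y hy) Φ (-((d * (2 * p)) • consIndexEquiv r ((1 : ℤ), 0))) ∧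
      -- the residual-section pin
      (∀ n : ℕ, Φ (algebraMap _ (ChartRing 𝒜 (⇑e.symm ∘ ![X 0, X 1] : Fin 2 → A) ![2, 1] (d * (2 * p)) y hy)
            (cobordantAlgebra.u' (⇑e.symm ∘ ![X 0, X 1] : Fin 2 → A) ![2, 1] 0 ^ n) *
          IsLocalization.Away.invSelf (coverElement 𝒜 (⇑e.symm ∘ ![X 0, X 1] : Fin 2 → A) ![2, 1] (d * (2 * p)) y hy)) =
        algebraMap (MvPolynomial (Option (Fin 4)) k) (Localization.Away hh) (X (some 0)) ^ n * IsLocalization.Away.invSelf hh) := by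
  letI := chartNodeGradedRing r 𝒜 (⇑e.symm ∘ ![X 0, X 1] : Fin 2 → A) ![2, 1] hf (d * (2 * p)) y hy
  obtain ⟨r0, r1, r2, r3, r4, r5⟩ := a1_model_rows σ hC h0 h1 h2 h3 e τ hact hp hσp hσJ r 𝒜 y hy hσy
  refine ⟨a1ModelEquiv e (coverElement 𝒜 (⇑e.symm ∘ ![X 0, X 1] : Fin 2 → A) ![2, 1] (d * (2 * p)) y hy),
    chartRingEquivAway 𝒜 (⇑e.symm ∘ ![X 0, X 1] : Fin 2 → A) ![2, 1] (d * (2 * p)) y hy (a1ModelEquiv e),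
    a1ModelEquiv_coverElement_one e r 𝒜 (p := p) d rfl y hyval hy, r0, r1, r2, r3, r4, r5, ?_, ?_, ?_, ?_, ?_, ?_, ?_, ?_⟩
  · rw [a1_modelSigma_apply_algebraMap e τ hp hσp hσJ r 𝒜 y hy hσy, a1_sigmaP_h e τ hp hσp hσJ r 𝒜 y hy hσy]
  · exact a1_model_degree_X_some_zero' e r 𝒜 hf y hy
  · exact a1_model_degree_X_some_two e r 𝒜 hf hx2 y hy
  · exact a1_model_degree_X_some_one' e r 𝒜 hf y hy
  · have h := map_algebraMap_mem_mapGrading r 𝒜 (⇑e.symm ∘ ![X 0, X 1] : Fin 2 → A) ![2, 1] hf (d * (2 * p)) y hy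
      (chartRingEquivAway 𝒜 (⇑e.symm ∘ ![X 0, X 1] : Fin 2 → A) ![2, 1] (d * (2 * p)) y hy (a1ModelEquiv e))
      (algebraMap_mem_reesPiece 𝒜 (⇑e.symm ∘ ![X 0, X 1] : Fin 2 → A) ![2, 1] hx3)
    rw [chartRingEquivAway_algebraMap, a1ModelEquiv_algebraMap_symm_X_three, Prod.mk_zero_zero, map_zero] at h
    exact h
  · exact a1_model_degree_X_none' e r 𝒜 hf y hy
  · exact a1_model_degree_invSelf' e r 𝒜 hf y hy
  · exact fun n => chartRingEquivAway_residualSection e r 𝒜 hf y hy n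

end Summit.ResolutionOfSingularities.ResolutionOfSingularities.Theorems.WildQuotientResolution.S1.KillCert.A1

end
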